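import Summits.BirchSwinnertonDyer.BirchSwinnertonDyer.Theorems.ThetaPartnerAtTwoSignedControlAtTwoReduce
import Summits.BirchSwinnertonDyer.BirchSwinnertonDyer.Theorems.ThetaPartnerAtTwoSignedControlAtTwoSignedCoinvChase
import Summits.BirchSwinnertonDyer.BirchSwinnertonDyer.Theorems.ThetaPartnerAtTwoSignedControlAtTwoSignedCasselsCount
import HarnessLib

/-!
# K4 `SignedControlAtTwo` (stmt-BirchSwinnertonDyer-20309) BY NAME from its three named residues
# {INJ⁺@2, Cassels' theorem (PUB), KIM⁺@2} — the composition of line `eulerchar` v4 as ONE landed theorem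

Route `ThetaPartnerAtTwo` (TP2; crux shared with `ResidualThetaTransportAtTwo`, RTT), crux K4, line `eulerchar` v4
(skeleton sha16 1933daf127d03c20, lead `prover-bsd-wall-tp2-p3`). Seat `prover-bsd-wall-tp2-p3-w3` (width seat 3/3).

WHAT. The registered skeleton `Cruxes/SignedControlAtTwo/Lines/eulerchar.lean` derives the crux from three stubs:
`stub_plusLocalInjTwo` (INJ⁺@2: «`r₂⁺` is injective», the `±` local theory at `2`), `stub_casselsPubTwo` (the Literature
named fact `Greenberg1999.casselsSurjectivity_H1Sigma ℚ`, Cassels' theorem = Greenberg LNM 1716 Prop. 4.13) and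
`stub_plusKimNoFiniteSubmoduleTwo` (KIM⁺@2: B. D. Kim 2013 Thm. 1.1 read at `2`). This file records that composition as
a THEOREM WITH THE THREE RESIDUES AS DISPLAYED HYPOTHESES, so that the conditional closure of K4 is citable by name
(by both routes) independently of the skeleton:

* `signedEulerCharTwo_of_plusLocalInj_of_casselsSurjectivity_of_plusKim` — (EC2) B. D. Kim's signed `Γ`-Euler
  characteristic at `2` on the sub-row `¬CM, r_an = 0, GoodSS 2, a₂ = 0` (= 19097 line `signed_halves_two` stub (2′)
  verbatim) from the three residues, through the lead's kernel theorems
  `SignedEC.signedEulerChar_two_of_localInj_of_cassels_of_kim` (p570923) and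
  `SignedEC.signedCasselsCountTwo_of_localInj_of_casselsSurjectivity` (p570665);
* `signedControlAtTwo_of_plusLocalInj_of_casselsSurjectivity_of_plusKim` — **K4 (route `ThetaPartnerAtTwo`) BY NAME**
  from the three residues (`ThetaPartnerXRoute.signedControlAtTwo_of_signedEulerCharAtTwo`, p526623);
(The RTT route's copy `Theses.ResidualThetaTransportAtTwo.SignedControlAtTwo` has the identical body; its one-line
derivation from the second theorem is left to that route's files, to keep this file off the RTT route module.)

HONEST FRAMING: THEOREMS ONLY (no definition, no named fact, no `sorry`); the three residues are HYPOTHESES (the second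
is a Literature named fact, so any instantiation is CONDITIONAL on Cassels' theorem); closes no item; BSD is not proved
by any of this.

References: [BDKim2013] B. D. Kim, J. Aust. Math. Soc. 95 (2013), Thm. 1.1, Cor. 3.15 (p. 199); [GreenbergLNM1716]
R. Greenberg, LNM 1716 (1999), §4 pp. 102–109, Prop. 4.13 (p. 122); [Kobayashi2003] S. Kobayashi, Invent. Math. 152
(2003), Def. 1.1, Thm. 1.2.
-/

set_option autoImplicit false
-- the Theorems namespace of this sub repeats the summit name by design (D-0017 nested layout)
set_option linter.dupNamespace false

noncomputable section

open scoped NumberField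

open WeierstrassCurve NumberField IsDedekindDomain Literature.NumberTheory.EllipticCurves
  Literature.NumberTheory.EllipticCurves.Rank1Residual
  Literature.NumberTheory.EllipticCurves.Kobayashi2003 Literature.NumberTheory.EllipticCurves.IwasawaDual

namespace Summit.BirchSwinnertonDyer.BirchSwinnertonDyer.Theorems.SignedEC

/-- **(EC2) from the three residues of line `eulerchar` v4.** On the sub-row `¬CM, r_an = 0, GoodSS 2, a₂ = 0`:
ASSUME (INJ⁺@2) every class of `A⁺_0 = h_0⁻¹(Sel⁺(E/ℚ_∞))` is classically Selmer at the place above `2`, for every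
cyclotomic `ℤ₂`-extension; (CASSELS) the named fact `Greenberg1999.casselsSurjectivity_H1Sigma ℚ`; (KIM⁺@2) for every
cyclotomic datum `(κ, γ)` and every Pontryagin-dual datum `D` of `Sel⁺(E/ℚ_∞)`, `X⁺ = D.X` torsion ⇒ no nonzero finite
`Λ`-submodule. THEN B. D. Kim's signed `Γ`-Euler characteristic at `2` holds: `Sel_{2^∞}(E/ℚ)` finite ⇒
`(Sel⁺_∞)^γ` finite and `#(Sel⁺_∞)^γ = u · 2^{ord₂ ∏ c_ℓ} · #Sel_{2^∞}(E/ℚ) · #(Sel⁺_∞)_γ`, `u ∈ ℤ₂ˣ`. Composition of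
`signedEulerChar_two_of_localInj_of_cassels_of_kim` with `signedCasselsCountTwo_of_localInj_of_casselsSurjectivity`.
[cite: BDKim2013, Cor. 3.15 (p. 199)] [cite: GreenbergLNM1716, §4 pp. 102–109 and Prop. 4.13 (p. 122)] -/
theorem signedEulerCharTwo_of_plusLocalInj_of_casselsSurjectivity_of_plusKim
    (hINJ : ∀ (W : WeierstrassCurve ℚ) [W.IsElliptic] [W.IsGloballyMinimal],
      ¬ W.HasCM → W.analyticRank = 0 → GoodSS W 2 → W.frobeniusTrace 2 = 0 →
      ∀ (κ : ZpExtension ℚ 2), κ.IsCyclotomic →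
      ∀ (v : HeightOneSpectrum (𝓞 ℚ)), (2 : 𝓞 ℚ) ∈ v.asIdeal →
      ∀ y ∈ (signedSelmerInfty W κ 1).comap (W.layerToInfty κ 0),
        W.localResOver 2 (κ.layerSubgroup 0) (v.adicCompletion ℚ) y = 0)
    (hC : Greenberg1999.casselsSurjectivity_H1Sigma ℚ)
    (hKIM : ∀ (W : WeierstrassCurve ℚ) [W.IsElliptic] [W.IsGloballyMinimal],
      ¬ W.HasCM → W.analyticRank = 0 → GoodSS W 2 → W.frobeniusTrace 2 = 0 →
      ∀ (κ : ZpExtension ℚ 2) (γ : Field.absoluteGaloisGroup ℚ), κ.IsCyclotomic → κ.IsTopGenerator γ →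
      ∀ (D : SignedSelmerDualData W κ γ 1) [Module.Finite (IwasawaAlgebra 2) D.X],
        Module.IsTorsion (IwasawaAlgebra 2) D.X →
        ∀ N : Submodule (IwasawaAlgebra 2) D.X, Finite N → N = ⊥) :
    ∀ (W : WeierstrassCurve ℚ) [W.IsElliptic] [W.IsGloballyMinimal],
      ¬ W.HasCM → W.analyticRank = 0 → GoodSS W 2 → W.frobeniusTrace 2 = 0 →
      ∀ (κ : ZpExtension ℚ 2) (γ : Field.absoluteGaloisGroup ℚ),
        κ.IsCyclotomic → κ.IsTopGenerator γ → Finite (W.selmerGroupPInfty 2) →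
        Finite (endInvariants (conjSignedSelmerInfty W κ 1 γ - 1)) ∧
          ∃ u : ℤ_[2]ˣ, (Nat.card (endInvariants (conjSignedSelmerInfty W κ 1 γ - 1)) : ℚ_[2]) =
            ((u : ℤ_[2]) : ℚ_[2]) * ((2 : ℕ) : ℚ_[2]) ^ (padicValNat 2 W.tamagawaProduct) *
              (Nat.card (W.selmerGroupPInfty 2) : ℚ_[2]) *
                (Nat.card (EndCoinvariants (conjSignedSelmerInfty W κ 1 γ - 1)) : ℚ_[2]) := by
  intro W _ _ hcm hr hss ha κ γ hκ hγ hSel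
  exact signedEulerChar_two_of_localInj_of_cassels_of_kim W κ hss hγ (hINJ W hcm hr hss ha κ hκ)
    (signedCasselsCountTwo_of_localInj_of_casselsSurjectivity W hC hss hκ (hINJ W hcm hr hss ha κ hκ))
    (fun D _ hX ↦ hKIM W hcm hr hss ha κ γ hκ hγ D hX) hSel

/-- **K4 `SignedControlAtTwo` (route `ThetaPartnerAtTwo`, item stmt-BirchSwinnertonDyer-20309) BY NAME from its three
named residues {INJ⁺@2, Cassels' theorem `Greenberg1999.casselsSurjectivity_H1Sigma ℚ`, KIM⁺@2}** — the composition of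
line `eulerchar` v4: conjunct (i) is Kobayashi's finite generation (tree theorem `SignedSelmerDualData.moduleFinite`),
conjunct (ii) is Greenberg's Lemma 4.2 on the dual pair applied to (EC2)
(`ThetaPartnerXRoute.signedControlAtTwo_of_signedEulerCharAtTwo`). CONDITIONAL on the displayed hypotheses; the
second is a Literature named fact (Cassels' theorem, Greenberg LNM 1716 Prop. 4.13).
[cite: BDKim2013, Thm. 1.1 and Cor. 3.15 (p. 199)] [cite: GreenbergLNM1716, Lemma 4.2, Prop. 4.13 (p. 122)]
[cite: Kobayashi2003, Thm. 1.2 (p. 2)] -/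
theorem signedControlAtTwo_of_plusLocalInj_of_casselsSurjectivity_of_plusKim
    (hINJ : ∀ (W : WeierstrassCurve ℚ) [W.IsElliptic] [W.IsGloballyMinimal],
      ¬ W.HasCM → W.analyticRank = 0 → GoodSS W 2 → W.frobeniusTrace 2 = 0 →
      ∀ (κ : ZpExtension ℚ 2), κ.IsCyclotomic →
      ∀ (v : HeightOneSpectrum (𝓞 ℚ)), (2 : 𝓞 ℚ) ∈ v.asIdeal →
      ∀ y ∈ (signedSelmerInfty W κ 1).comap (W.layerToInfty κ 0),
        W.localResOver 2 (κ.layerSubgroup 0) (v.adicCompletion ℚ) y = 0)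
    (hC : Greenberg1999.casselsSurjectivity_H1Sigma ℚ)
    (hKIM : ∀ (W : WeierstrassCurve ℚ) [W.IsElliptic] [W.IsGloballyMinimal],
      ¬ W.HasCM → W.analyticRank = 0 → GoodSS W 2 → W.frobeniusTrace 2 = 0 →
      ∀ (κ : ZpExtension ℚ 2) (γ : Field.absoluteGaloisGroup ℚ), κ.IsCyclotomic → κ.IsTopGenerator γ →
      ∀ (D : SignedSelmerDualData W κ γ 1) [Module.Finite (IwasawaAlgebra 2) D.X],
        Module.IsTorsion (IwasawaAlgebra 2) D.X →
        ∀ N : Submodule (IwasawaAlgebra 2) D.X, Finite N → N = ⊥) :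
    Summit.BirchSwinnertonDyer.BirchSwinnertonDyer.Theses.ThetaPartnerAtTwo.SignedControlAtTwo :=
  ThetaPartnerXRoute.signedControlAtTwo_of_signedEulerCharAtTwo
    (signedEulerCharTwo_of_plusLocalInj_of_casselsSurjectivity_of_plusKim hINJ hC hKIM)

end Summit.BirchSwinnertonDyer.BirchSwinnertonDyer.Theorems.SignedEC

end
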